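import Literature.MathematicalPhysics.QuantumManyBody.PeriodicBoseGas
import Literature.MathematicalPhysics.QuantumManyBody.PeriodizedPotentialNearestImage
import Literature.MathematicalPhysics.QuantumManyBody.PeriodicGroundStateFeynmanKacProofs
import Literature.MathematicalPhysics.QuantumManyBody.PeriodicKyFanGapFeynmanKac
import Literature.MathematicalPhysics.QuantumManyBody.PeriodicClusteringFromKyFanGap
import Literature.MathematicalPhysics.QuantumManyBody.CondensateOccupationStability

/-!
# Route `BECThomsonPrinciple`, crux `PeriodicToDirichlet` (stmt-AtomisticToContinuum-9483),
# line `entropy-swap`: registered stub `stub_torusCondensateFloor`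

The hypothesis `A` (periodic BEC: on the torus of side `L_N(ρ) = (N/ρ)^{1/3}`, eventually in `N`,
every periodic `δ_N`-near-minimiser `Ψ` has constant-mode occupation `n₀(Ψ) ≥ cN` for SOME
`δ_N > 0`) reaches the Feynman–Kac torus GROUND STATE `Φ` (`IsPeriodicGroundStateFK v L Φ`), read as
the complex function `X ↦ (Φ X : ℂ)`, with the constant `c/2` and the index shift `N = n + 1`.

Mechanism (bounded `v` of finite range `R₀`): once `2R₀ < L` the periodised potential is a single
lattice image (`exists_periodizedPotential_eq_single`), hence bounded, so the two-level Rayleigh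
bound below the simple Feynman–Kac ground state (`IsPeriodicGroundStateFK.exists_twoLevel`) and its
variational reading (`ofReal_le_periodicEnergy_of_twoLevel`:
`E₀ + γ (1 - |⟨Φ, Ψ⟩_cell|²) ≤ 𝓔^per[Ψ]`) give, for every `(γη/2)`-near-minimiser `Ψ`,
`∫_cell |Ψ - e^{iθ}Φ|² = 2 - 2|⟨Ψ, Φ⟩_cell| ≤ η` with `θ = -arg ⟨Ψ, Φ⟩_cell`. A near-minimiser at
slack `min(δ_N, γη/2)` exists (`E₀ ≠ ⊤` is an infimum), it carries `n₀ ≥ cN` by `A`, and the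
`2N√η`-Lipschitz continuity of `n₀` on the unit ball of `L²(cell)`
(`condensateOccupation_le_add_of_sq_dist_le`) with phase invariance
(`condensateOccupation_phase_mul`) moves the floor onto `Φ`: with `η = (c/4)²`,
`cN ≤ n₀(Φ) + (c/2)N`. [folklore]
-/

noncomputable section

open MeasureTheory Filter
open scoped ENNReal NNReal ComplexConjugate

namespace Summit.AtomisticToContinuum.BoseEinsteinCondensation.EntropySwap

open Literature.MathematicalPhysics.QuantumManyBody.BoseGas

/-! ### Private helpers -/

/-- `L_N = (N/ρ)^{1/3} → ∞` along `N = m + 1`. [folklore] -/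
private theorem tendsto_sideLength_succ {ρ : ℝ} (hρ : 0 < ρ) :
    Tendsto (fun m : ℕ => sideLength ρ (m + 1)) atTop atTop := by
  have h : Tendsto (fun n : ℕ => sideLength ρ n) atTop atTop := by
    unfold sideLength
    exact (tendsto_rpow_atTop (by norm_num : (0 : ℝ) < 1 / 3)).comp
      (tendsto_natCast_atTop_atTop.atTop_div_const hρ)
  exact h.comp (tendsto_add_atTop_nat 1)

/-- `∫ ‖F - G‖² = ∫ ‖F‖² - 2 Re ∫ conj F · G + ∫ ‖G‖²` for `F, G ∈ L²(μ; ℂ)`. [folklore] -/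
private theorem integral_norm_sub_sq_eq {α : Type*} [MeasurableSpace α] {μ : Measure α}
    {F G : α → ℂ} (hF : MemLp F 2 μ) (hG : MemLp G 2 μ) :
    ∫ x, ‖F x - G x‖ ^ 2 ∂μ =
      (∫ x, ‖F x‖ ^ 2 ∂μ) - 2 * (∫ x, conj (F x) * G x ∂μ).re + ∫ x, ‖G x‖ ^ 2 ∂μ := by
  have hpt : ∀ x, ‖F x - G x‖ ^ 2 = (‖F x‖ ^ 2 - 2 * (conj (F x) * G x).re) + ‖G x‖ ^ 2 := by
    intro x
    rw [@norm_sub_sq ℂ, RCLike.inner_apply', RCLike.re_to_complex]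
  have hFc : MemLp (fun x => conj (F x)) 2 μ :=
    hF.of_le (Complex.continuous_conj.comp_aestronglyMeasurable hF.1)
      (Eventually.of_forall fun x => by rw [Complex.norm_conj])
  have hFG : Integrable (fun x => conj (F x) * G x) μ := hFc.integrable_mul hG
  have hF2 : Integrable (fun x => ‖F x‖ ^ 2) μ := hF.norm.integrable_sq
  have hG2 : Integrable (fun x => ‖G x‖ ^ 2) μ := hG.norm.integrable_sq
  have hre : Integrable (fun x => 2 * (conj (F x) * G x).re) μ := by
    have := hFG.re.const_mul 2
    simpa only [RCLike.re_to_complex] using this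
  have hre_eq : ∫ x, (conj (F x) * G x).re ∂μ = (∫ x, conj (F x) * G x ∂μ).re := by
    have := integral_re hFG
    simpa only [RCLike.re_to_complex] using this
  simp_rw [hpt]
  rw [integral_add (f := fun x => ‖F x‖ ^ 2 - 2 * (conj (F x) * G x).re) (g := fun x => ‖G x‖ ^ 2)
      (hF2.sub hre) hG2,
    integral_sub (f := fun x => ‖F x‖ ^ 2) (g := fun x => 2 * (conj (F x) * G x).re) hF2 hre,
    integral_const_mul, hre_eq]

/-- **The distance to the ground state up to a phase**: for a periodic trial state `Ψ`, a real
`Φ ∈ L²(cell)` with `∫_cell Φ² = 1`, `s = ∫_cell conj Ψ · Φ` and the phase `θ = -arg s`,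
`∫_cell |Ψ - e^{iθ}Φ|² = 2 - 2|s|`. [folklore] -/
private theorem integral_norm_sub_phase_mul_sq {N : ℕ} {L : ℝ} (Ψ : PeriodicTrialState N L)
    {Φ : Config N → ℝ} (hΦ : MemLp Φ 2 (volume.restrict (cellN N L)))
    (hΦ1 : ∫ X in cellN N L, Φ X ^ 2 = 1) :
    ∫ X in cellN N L, ‖Ψ.ψ X -
        Complex.exp (↑(-(Complex.arg (∫ Y in cellN N L, conj (Ψ.ψ Y) * (Φ Y : ℂ)))) * Complex.I) *
          (Φ X : ℂ)‖ ^ 2 =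
      2 - 2 * ‖∫ Y in cellN N L, conj (Ψ.ψ Y) * (Φ Y : ℂ)‖ := by
  set s : ℂ := ∫ Y in cellN N L, conj (Ψ.ψ Y) * (Φ Y : ℂ) with hs
  set c : ℂ := Complex.exp (↑(-(Complex.arg s)) * Complex.I) with hc
  have hc1 : ‖c‖ = 1 := Complex.norm_exp_ofReal_mul_I _
  have hcs : c * s = (‖s‖ : ℂ) := by
    conv_lhs => rw [← Complex.norm_mul_exp_arg_mul_I s]
    rw [hc, mul_left_comm, ← Complex.exp_add]
    have : (↑(-(Complex.arg s)) : ℂ) * Complex.I + ↑(Complex.arg s) * Complex.I = 0 := by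
      push_cast; ring
    rw [this, Complex.exp_zero, mul_one]
  have hG : MemLp (fun X => c * (Φ X : ℂ)) 2 (volume.restrict (cellN N L)) :=
    (hΦ.ofReal (K := ℂ)).const_mul c
  rw [integral_norm_sub_sq_eq Ψ.memLp_two hG]
  -- `∫ ‖Ψ‖² = 1`
  have h1 : ∫ X in cellN N L, ‖Ψ.ψ X‖ ^ 2 = 1 := by
    rw [integral_cellN_norm_sq_eq_toReal L Ψ.contDiff.continuous, Ψ.norm_eq, ENNReal.toReal_one]
  -- `∫ ‖cΦ‖² = 1`
  have h2 : ∫ X in cellN N L, ‖c * (Φ X : ℂ)‖ ^ 2 = 1 := by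
    rw [← hΦ1]
    refine integral_congr_ae (Eventually.of_forall fun X => ?_)
    simp only [norm_mul, hc1, one_mul, Complex.norm_real, Real.norm_eq_abs, sq_abs]
  -- `∫ conj Ψ · cΦ = c s = |s|`
  have h3 : ∫ X in cellN N L, conj (Ψ.ψ X) * (c * (Φ X : ℂ)) = (‖s‖ : ℂ) := by
    rw [← hcs, hs, ← integral_const_mul]
    refine integral_congr_ae (Eventually.of_forall fun X => ?_)
    simp only
    ring
  rw [h1, h2, h3, Complex.ofReal_re]
  ring

/-- **Near-minimisers are close to the Feynman–Kac ground state up to a phase** (fixed `N`, `L`):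
for measurable `v` with bounded periodisation `v^per ≤ C` on the torus of side `L > 0` and a
Feynman–Kac ground state `Φ`, for every `η > 0` there is `δ > 0` such that every periodic
`δ`-near-minimiser `Ψ` satisfies `∫_cell |Ψ - e^{iθ}Φ|² ≤ η` for some phase `θ` (two-level Rayleigh
bound below the simple ground state, `E₀ + γ(1 - |⟨Φ,Ψ⟩|²) ≤ 𝓔^per[Ψ]`). [folklore] -/
private theorem exists_phase_sq_dist_le {N : ℕ} {L : ℝ} (hL : 0 < L) {v : ℝ → ℝ≥0∞}
    (hvm : Measurable v) {C : ℝ≥0} (hC : ∀ x, periodizedPotential v L x ≤ C) {Φ : Config N → ℝ}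
    (hΦ : IsPeriodicGroundStateFK v L Φ) {η : ℝ} (hη : 0 < η) :
    ∃ δ : ℝ≥0∞, 0 < δ ∧ ∀ Ψ : PeriodicTrialState N L,
      periodicEnergy v Ψ ≤ periodicGroundStateEnergy v N L + δ →
        ∃ θ : ℝ, ∫ X in cellN N L, ‖Ψ.ψ X - Complex.exp (θ * Complex.I) * (Φ X : ℂ)‖ ^ 2 ≤ η := by
  obtain ⟨γ, hγ, htwo⟩ := hΦ.exists_twoLevel hvm hL hC
  refine ⟨ENNReal.ofReal (γ * η / 2), ENNReal.ofReal_pos.2 (by positivity), fun Ψ hΨ => ?_⟩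
  have hE : periodicGroundStateEnergy v N L ≠ ⊤ := hΦ.energy_ne_top
  have hlow := ofReal_le_periodicEnergy_of_twoLevel hL hvm hC
    (fun f => ∫ X in cellN N L, Φ X * f X) (fun k => by positivity)
    (tendsto_pow_atTop_nhds_zero_of_lt_one (by norm_num) (by norm_num)) htwo Ψ
  dsimp only at hlow
  set E₀ : ℝ := (periodicGroundStateEnergy v N L).toReal with hE₀
  set A : ℝ := (∫ X in cellN N L, Φ X * (Ψ.ψ X).re) ^ 2 +
    (∫ X in cellN N L, Φ X * (Ψ.ψ X).im) ^ 2 with hAdef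
  have hA : 1 - A ≤ η / 2 := by
    have h1 : ENNReal.ofReal (E₀ + γ * (1 - A)) ≤ ENNReal.ofReal (E₀ + γ * η / 2) := by
      calc ENNReal.ofReal (E₀ + γ * (1 - A)) ≤ periodicEnergy v Ψ := hlow
        _ ≤ periodicGroundStateEnergy v N L + ENNReal.ofReal (γ * η / 2) := hΨ
        _ = ENNReal.ofReal (E₀ + γ * η / 2) := by
            rw [ENNReal.ofReal_add ENNReal.toReal_nonneg (by positivity),
              ENNReal.ofReal_toReal hE]
    have h2 := (ENNReal.ofReal_le_ofReal_iff (by positivity)).1 h1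
    nlinarith
  -- the overlap `s = ⟨Ψ, Φ⟩_cell`, `|s|² = A`
  set s : ℂ := ∫ Y in cellN N L, conj (Ψ.ψ Y) * (Φ Y : ℂ) with hs
  have hsA : ‖s‖ ^ 2 = A := norm_sq_setIntegral_conj_mul_ofReal hΦ.memLp_two Ψ
  refine ⟨-(Complex.arg s), ?_⟩
  rw [integral_norm_sub_phase_mul_sq Ψ hΦ.memLp_two hΦ.setIntegral_sq]
  by_cases hs1 : ‖s‖ ≤ 1
  · nlinarith [mul_nonneg (sub_nonneg.2 hs1) (norm_nonneg s)]
  · push Not at hs1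
    linarith

/-- **The floor transfer at fixed `N`, `L`.** If every periodic `δ`-near-minimiser (`δ > 0`) has
`n₀ ≥ cN`, then the Feynman–Kac ground state `Φ` (bounded periodisation, `L > 0`, `Φ` continuous)
has `n₀(Φ) ≥ (c/2)N`: a near-minimiser at slack `min(δ, δ_η)` exists since `E₀ ≠ ⊤` is an infimum,
it is `η = (c/4)²`-close to `e^{iθ}Φ` in `L²(cell)`, and `n₀` is phase invariant and
`2N√η`-Lipschitz on the unit ball. [folklore] -/
private theorem floor_transfer {N : ℕ} {L : ℝ} (hL : 0 < L) {v : ℝ → ℝ≥0∞} (hvm : Measurable v)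
    {C : ℝ≥0} (hC : ∀ x, periodizedPotential v L x ≤ C) {Φ : Config N → ℝ}
    (hΦ : IsPeriodicGroundStateFK v L Φ) (hcont : Continuous Φ) {c : ℝ} (hc : 0 < c)
    {δ : ℝ≥0∞} (hδ : 0 < δ)
    (hfloor : ∀ Ψ : PeriodicTrialState N L,
      periodicEnergy v Ψ ≤ periodicGroundStateEnergy v N L + δ →
        ENNReal.ofReal (c * N) ≤ condensateOccupation N L Ψ.ψ) :
    ENNReal.ofReal (c / 2 * N) ≤ condensateOccupation N L (fun X => (Φ X : ℂ)) := by
  obtain ⟨δ₁, hδ₁, hnear⟩ :=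
    exists_phase_sq_dist_le hL hvm hC hΦ (η := (c / 4) ^ 2) (by positivity)
  have hδ' : 0 < min δ δ₁ := lt_min hδ hδ₁
  -- a near-minimiser at slack `min δ δ₁` exists: `E₀ ≠ ⊤` is an infimum
  obtain ⟨Ψ, hΨ⟩ : ∃ Ψ : PeriodicTrialState N L,
      periodicEnergy v Ψ < periodicGroundStateEnergy v N L + min δ δ₁ :=
    iInf_lt_iff.1 (ENNReal.lt_add_right hΦ.energy_ne_top hδ'.ne')
  have hΨδ : periodicEnergy v Ψ ≤ periodicGroundStateEnergy v N L + δ :=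
    hΨ.le.trans (add_le_add le_rfl (min_le_left _ _))
  have hΨδ₁ : periodicEnergy v Ψ ≤ periodicGroundStateEnergy v N L + δ₁ :=
    hΨ.le.trans (add_le_add le_rfl (min_le_right _ _))
  have hocc := hfloor Ψ hΨδ
  obtain ⟨θ, hθ⟩ := hnear Ψ hΨδ₁
  -- `e^{iθ}Φ` is continuous and cell-normalised
  have hcΦ : Continuous fun X => Complex.exp (θ * Complex.I) * (Φ X : ℂ) :=
    continuous_const.mul (Complex.continuous_ofReal.comp hcont)
  have hΦ1 : ∫⁻ X in cellN N L, (‖Complex.exp (θ * Complex.I) * (Φ X : ℂ)‖₊ : ℝ≥0∞) ^ 2 ≤ 1 := by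
    simp only [coe_nnnorm_mul_sq, coe_nnnorm_exp_mul_I_sq, one_mul]
    refine le_of_eq (Eq.trans (lintegral_congr fun X => ?_) hΦ.norm_eq)
    rw [ennnorm_sq_ofReal_periodic, ENNReal.ofReal_pow (hΦ.nonneg X)]
  -- Lipschitz continuity of `n₀` and phase invariance
  have hlip := condensateOccupation_le_add_of_sq_dist_le hL Ψ.contDiff.continuous hcΦ
    Ψ.norm_eq.le hΦ1 hθ
  rw [condensateOccupation_phase_mul, Real.sqrt_sq (by positivity : (0 : ℝ) ≤ c / 4)] at hlip
  have key : ENNReal.ofReal (c * N) ≤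
      condensateOccupation N L (fun X => (Φ X : ℂ)) + ENNReal.ofReal (c / 2 * N) := by
    refine hocc.trans (hlip.trans (le_of_eq ?_))
    congr 2
    ring
  have h := ofReal_sub_mul_le_of_le_add (by positivity : (0 : ℝ) ≤ c / 2) N key
  have h2 : c - c / 2 = c / 2 := by ring
  rwa [h2] at h

/-! ### The stub -/

/-- **Registered stub `stub_torusCondensateFloor`** (stub 1a of line `entropy-swap`, crux
stmt-AtomisticToContinuum-9483): the hypothesis `A` (periodic BEC for all `δ_N`-near-minimisers on
the torus of side `sideLength ρ N`, eventually in `N`) gives, for the same densities and eventually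
in `n`, the floor `n₀(Φ) ≥ (c/2)(n+1)` for every continuous Feynman–Kac torus ground state `Φ` of
`n + 1` particles, for BOUNDED `v` of finite range. [folklore] -/
theorem stub_torusCondensateFloor :
    ∀ v : ℝ → ℝ≥0∞, IsRepulsiveFiniteRange v → (∃ B : ℝ≥0, ∀ r, 0 ≤ r → v r ≤ B) →
      (∃ ρ₀ : ℝ, 0 < ρ₀ ∧ ∀ ρ : ℝ, 0 < ρ → ρ < ρ₀ → ∃ c : ℝ, 0 < c ∧ ∀ᶠ N : ℕ in atTop,
        ∃ δ : ℝ≥0∞, 0 < δ ∧ ∀ Ψ : PeriodicTrialState N (sideLength ρ N),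
          periodicEnergy v Ψ ≤ periodicGroundStateEnergy v N (sideLength ρ N) + δ →
            ENNReal.ofReal (c * N) ≤ condensateOccupation N (sideLength ρ N) Ψ.ψ) →
      ∃ ρ₁ : ℝ, 0 < ρ₁ ∧ ∀ ρ : ℝ, 0 < ρ → ρ < ρ₁ → ∃ c : ℝ, 0 < c ∧ ∀ᶠ n : ℕ in atTop,
        ∀ Φ : Config (n + 1) → ℝ, IsPeriodicGroundStateFK v (sideLength ρ (n + 1)) Φ → Continuous Φ →
          ENNReal.ofReal (c * (n + 1)) ≤
            condensateOccupation (n + 1) (sideLength ρ (n + 1)) (fun X => (Φ X : ℂ)) := by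
  intro v hv hbdd hA
  obtain ⟨hvm, R₀, hR₀⟩ := hv
  obtain ⟨B, hB⟩ := hbdd
  obtain ⟨ρ₀, hρ₀, hAρ⟩ := hA
  refine ⟨ρ₀, hρ₀, fun ρ hρ hρ' => ?_⟩
  obtain ⟨c, hc, hev⟩ := hAρ ρ hρ hρ'
  refine ⟨c / 2, by positivity, ?_⟩
  filter_upwards [(tendsto_add_atTop_nat 1).eventually hev,
    (tendsto_sideLength_succ hρ).eventually_gt_atTop (2 * R₀),
    (tendsto_sideLength_succ hρ).eventually_gt_atTop 0] with n hAn h2R hL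
  intro Φ hΦ hcont
  obtain ⟨δ, hδ, hfloor⟩ := hAn
  -- the periodisation is bounded by `B` once `2R₀ < L` (a single near image)
  have hC : ∀ x, periodizedPotential v (sideLength ρ (n + 1)) x ≤ (B : ℝ≥0∞) := fun x => by
    obtain ⟨n₀, hn₀⟩ := exists_periodizedPotential_eq_single hR₀ h2R hL x
    rw [hn₀]
    exact hB _ (norm_nonneg _)
  have key := floor_transfer hL hvm hC hΦ hcont hc hδ hfloor
  have hcast : c / 2 * ((n + 1 : ℕ) : ℝ) = c / 2 * ((n : ℝ) + 1) := by push_cast; ring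
  rwa [hcast] at key

end Summit.AtomisticToContinuum.BoseEinsteinCondensation.EntropySwap

end
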